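import Literature.MathematicalPhysics.QuantumFieldTheory.Balaban1983to89.B15Prop1MinimiserFamilyOfNormalisedSlice
import Literature.MathematicalPhysics.QuantumFieldTheory.Balaban1983to89.B15Prop1MinimiserFamilyGaugeCovarianceB

/-!
# `Balaban1983to89.B15Prop1MinimiserFamilyOfNormalisedSlice` — [Balaban1989LargeFieldI] = «[IV]», p. 193 (the extension `Ṽ_k`), p. 194, the sentence after (1.77) («The function is invariant — **BOND-DATUM EDITION** (`…B15Prop1MinimiserFamilyOfNormalisedSliceB`, USED DECLARATIONS ONLY): the print-datum ([Balaban1984PropagatorsII] (2.3)) twins of the declarations of `B15Prop1MinimiserFamilyOfNormalisedSlice` that N12's junction of record v14ᴸ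
uses with a datum-bearing statement (`hMinBody_of_datumSlice`) — class (γ) of dag-n12-c's census-by-declaration v2 (bus [DAGN12C-G35], 2026-08-30).  GENERATOR (block-extracted from the
parent's tree bytes by HOME `lean/g35/gen/gen_blocks.py`): namespace `…B`, SAME names, `DetSet ↦ BDetSet` (F0a), `AgreeOn ↦ AgreeOnB`, `IsMinimizer ↦ IsMinimizerB`, `bondsOf (𝐁 j) ↦ 𝔅 j`, `constrCard ∕
constrEnum ∕ ConstrSet ∕ msChart ↦ …B` (lane `Node00/MultiScaleFibreChartB`), `IsCritOnFibre ∕ IsFibreChartNear ↦ …B`; proofs VERBATIM; the parent's other (datum-free) declarations REUSED by `open`.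

statement-level skeleton of published theorems with citation tags; proofs where landed; nothing here is a claim about
the Yang–Mills mass gap

Cell `pub-ymgap` (HUMAN RULINGS D-0062 ∕ D-0149), lane `pub-ymgap-dag-n12-c` g35 (R134 seat (a), N12 = [B15], s1, lane owner); `--kind proof --supports` K1⁹ `stmt-QuantumFields-27364`; count-neutral.
THEOREMS ONLY (0 `def`, 0 `instance`, 0 `sorry`).  HONESTY GUARD (director-ym №338 (5)): PURELY ADDITIVE — the parent stays landed and true on its own text; nothing in it is edited; no displayed
premise of any consumer is deleted or weakened; every hypothesis stays a hypothesis.  Nothing of Bałaban's analysis asserted; N12 NOT discharged; K0⁷ ∕ K1⁹ NOT closed; one finite 𝕋⁴ programme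
at fixed ε — nothing continuum ∕ ℝ⁴ ∕ OS; the Yang–Mills mass gap (Clay) is NOT proved by any of this.

PARENT's DOCSTRING (mathematics and citations; read `𝐁` as the bond datum `𝔅`):
# `Balaban1983to89.B15Prop1MinimiserFamilyOfNormalisedSlice` — [Balaban1989LargeFieldI] = «[IV]», p. 193 (the extension `Ṽ_k`), p. 194, the sentence after (1.77) («The function is invariant
# with respect to the group of all gauge transformations defined on Λ, hence it is natural to consider it on orbits of this group»); [Balaban1989LargeFieldII] = «[LF-II]», p. 357, p. 358:
# ★★★ THE (J0′) LETTER FOR EVERY BASE FIELD OF THE STRICT GUARD FROM THE (J0′) LETTER ON THE NORMALISED SLICE — the per-base-field datum antecedent REMOVED along the gauge orbit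

Honest framing: statement-level skeleton of published theorems with citation tags; proofs where landed; nothing here is a claim about the Yang–Mills mass gap.  Cell `pub-ymgap`
(HUMAN RULINGS D-0062 ∕ D-0149), lane `pub-ymgap-dag-n12-c` g27 (R134 seat (a), N12 = [B15], s1); count-neutral helper of K1⁹ `stmt-QuantumFields-27364` (`--kind proof --supports`);
N12 NOT discharged; one finite 𝕋⁴ programme at fixed ε; nothing continuum ∕ ℝ⁴ ∕ OS ∕ mass-gap ∕ Clay.  THEOREMS ONLY (0 `def`, 0 `instance`, 0 `sorry`).

WHY (the lane's LOCATED-GAUGE-ORBIT and its repair, cell bus 2026-08-29).  After `B15Prop1MinimiserFamilyGaugeCovariance` the knit-side junctions of the (J0′) road deliver, per instance,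
«`∃ R > 0, ∀ V_k`, strict guard → (datum letter `∀ c ∈ 𝒞, dist1 ((ext V_k) c) ≤ ρn`) → hMin-body(`V_k, R, 𝓐₀`)» (dag-n12-d's normalised-slice junction, INTENT-96 v3).  THIS FILE removes the
datum antecedent for EVERY base field of the strict guard when the bond set `𝒞` lies in a REGION BOX `[LO, HI] ⊇ [lo − 1, hi + 1]` of the `k`-lattice whose plaquettes lie in `Z^{(k)}` and the
datum tolerance `ρn` dominates dag-n12-w6's normalisation bound at the guard radius `eR` (the direct road's `hR′` ∕ `hρn` rows, v11): for `V_k` in the strict guard, w6's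
`B15Prop1DatumGaugeNormalisation.exists_gauge_normalising_extend_shellGauged` gives `ũ` with `ũ = 1` on `Λ^{(k)}` and at the corner, `ext(V_k^{ũ}) = (ext V_k)^{ũ}`, and `(ext V_k)^{ũ}`
bondwise within the bound on `boxBonds LO HI ⊇ 𝒞`; `V_k^{ũ}` is in the guard (plaquette deviations are orbit invariants, `B15Prop1Carrier.dist1_plaqHol_gaugeAct`); so the slice letter
gives the hMin-body at `V_k^{ũ}` with `(R, 𝓐)`, and `B15Prop1MinimiserFamilyGaugeCovariance.hMinBody_of_gaugeAct_normalised` returns it to `V_k` with `(R∕3, 4𝓐)` — print's p. 194 orbit reduction,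
executed.  WHAT STAYS DISPLAYED (instance level, honest scope): the box rows `hLO hHI hn' hn'N hR` and `𝒞 ⊆ boxBonds LO HI` — the BOX SCOPE of the direct road (LOCATED-GEOM v2∕v3: for a
general, non-box-like small-field component a region tree gauge with holonomy control would be needed; not here).

CONTENTS.  ★★★ `hMinBody_of_datumSlice` (NODE 00's objects: `avOfRecord F 2 Kt`, `regMSCoPOfRecord F 2 ν Kt k (maxDomT ν.M₁ Z)`, `Bj ν.M₁ Z k`; the knit's window rows `hlohi hn hN hbox hZ`,
the region box rows, the guard radius `eR > 0`, the datum tolerance row; the slice letter `hslice` as hypothesis).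
HONEST SCOPE: one composition by name; nothing of Bałaban's estimates asserted; count-neutral; N12 NOT discharged; K1⁹ NOT closed; R4 closes only the conditional finite-𝕋⁴ rung
`BalabanLadder.UV` — no summit statement is proved here and NOT the Yang–Mills mass gap (Clay); nothing continuum ∕ ℝ⁴ ∕ OS.
-/


noncomputable section

open Set Metric
open scoped Matrix.Norms.L2Operator

namespace Literature.MathematicalPhysics.QuantumFieldTheory.Balaban1983to89.B15Prop1MinimiserFamilyOfNormalisedSliceB

open B15Prop1MinimiserFamilyOfNormalisedSlice


open B15DeterminingSetsB

open GaugeField B15DeterminingSets B16Sect1Backgrounds T4Continuum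
open B15Prop1ChartSU2 (su2Chart)
open B15Prop1ChartCalculusSU2 (E3)
open B15Prop1AnalyticExtClause (cplxVec)
open B15Prop1Carrier (plaqsInside dist1_plaqHol_gaugeAct)
open B15Prop1DatumGaugeNormalisation (exists_gauge_normalising_extend_shellGauged)
open B15Prop1MinimiserFamilyGaugeCovarianceB (hMinBody_of_gaugeAct_normalised)
open B14.Eq213DetSet (Bj maxDomT)
open T4AxialGaugeSmallField (castSite boxPlaqs boxBonds)
open B15Extension193 (extend)
open B15ShellGauge193 (shellGauge)
open Literature.MathematicalPhysics.QuantumFieldTheory.BalabanImbrieJaffe1984to88.BIJ85Eq453GaugeField (qsstarGIter0)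
open T4CubeChartGnomonic (SU2)



section

/-- ★★★ **THE (J0′) LETTER FOR EVERY BASE FIELD OF THE STRICT GUARD FROM THE LETTER ON THE NORMALISED SLICE.**  Instance level: NODE 00's objects at `(ν, Kt, k, Z)`, the knit's window
`Λ^{(k)} = castSite '' [lo, hi]` deep inside `Z` (`hbox`, `hZ`, `hn`, `hN`, `hlohi`), a REGION BOX `[LO, HI] ⊇ [lo − 1, hi + 1]` with plaquettes in `Z^{(k)}` (`hLO hHI hn' hn'N hR` — the direct
road's rows), print's extension `ext = extend (pts k Λ) (shellGauge · lo hi)`, a bond set `𝒞 ⊆ boxBonds LO HI`, the guard radius `eR > 0` and a datum tolerance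
`ρn ≥ (d·n′+1)((d−1)·n′·((12d(n+2)²+1)·eR) + 3d(n+2)²·eR)` (w6's normalisation bound).  IF the hMin-body with `(R, 𝓐)` holds for every base field of the strict guard that satisfies the datum
letter `∀ c ∈ 𝒞, dist1 ((ext W) c) ≤ ρn` (`hslice`), THEN it holds with `(R∕3, 4𝓐)` for EVERY base field of the strict guard.
[cite: Balaban1989LargeFieldI, p.193, p.194 (sentence after (1.77)); Balaban1989LargeFieldII, p.357, p.358, (1.12)–(1.13) p.359; Balaban1985Variational, (181) p.307; Balaban1985Averaging, (8)–(9) p.19; Balaban1988Convergent, (2.12) p.256] -/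
theorem hMinBody_of_datumSlice {F : T4Family} (ν : Node00.Stage7Numerics) (Kt : ℕ) {k : ℕ} (hk : k ≤ (F.P Kt).m + (F.P Kt).K) (hd3 : 3 ≤ (F.P Kt).d)
    (bd : ℕ → (ℕ → Set (Site (F.P Kt) 0)) → BDetSet (F.P Kt)) (Z Λ : Set (Site (F.P Kt) 0))
    (hbd : ∀ j, (F.P Kt).m + (F.P Kt).K < j → bd k (maxDomT ν.M₁ Z) j = ∅) {lo hi : Fin (F.P Kt).d → ℤ} (hlohi : lo ≤ hi) {n : ℕ} (hn : ∀ κ, hi κ ≤ lo κ + n)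
    (hN : ∀ κ, hi κ - lo κ + 3 < ((F.P Kt).sitesPerDir k : ℤ))
    (hbox : pts k Λ = (castSite '' Set.Icc lo hi : Set (Site (F.P Kt) k)))
    (hZ : (boxPlaqs (lo - 1) (hi + 1) : Set (Plaq (F.P Kt) k)) ⊆ plaqsInside (pts k Z))
    -- the REGION BOX (the direct road's rows)
    {LO HI : Fin (F.P Kt).d → ℤ} (hLO : LO ≤ lo - 1) (hHI : hi + 1 ≤ HI) {n' : ℕ} (hn' : ∀ κ, HI κ ≤ LO κ + n')
    (hn'N : n' < (F.P Kt).sitesPerDir k) (hR : (boxPlaqs LO HI : Set (Plaq (F.P Kt) k)) ⊆ plaqsInside (pts k Z))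
    -- print's extension
    (ext : GaugeField (F.P Kt) k SU2 → GaugeField (F.P Kt) k SU2) (hext : ∀ V, ext V = extend (pts k Λ) (shellGauge V lo hi) V)
    -- the bond set of the datum letter lies in the region box; guard radius and datum tolerance
    (𝒞 : Set (PBond (F.P Kt) k)) (h𝒞 : 𝒞 ⊆ (boxBonds LO HI : Set (PBond (F.P Kt) k))) {eR ρn : ℝ} (heR : 0 < eR)
    (hρn : (((F.P Kt).d : ℝ) * n' + 1) * ((((F.P Kt).d - 1 : ℕ) : ℝ) * n' * ((12 * (F.P Kt).d * (n + 2) ^ 2 + 1) * eR)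
      + 3 * (F.P Kt).d * (n + 2) ^ 2 * eR) ≤ ρn)
    {R 𝓐 : ℝ}
    -- THE (J0′) LETTER ON THE NORMALISED SLICE (dag-n12-d's junction output, per instance)
    (hslice : ∀ W : GaugeField (F.P Kt) k SU2, PlaqSmallOn (plaqsInside (pts k (Z ∩ Λᶜ))) eR W → (∀ c ∈ 𝒞, dist1 ((ext W) c) ≤ ρn) →
      ∃ Ũ : VecField (F.P Kt) k (EuclideanSpace ℂ (Fin 3)) × VecField (F.P Kt) k (EuclideanSpace ℂ (Fin 3)) → PBond (F.P Kt) 0 → Matrix (Fin 2) (Fin 2) ℂ,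
        (∀ b i j, DifferentiableOn ℂ (fun z => Ũ z b i j) (ball 0 R)) ∧
        (∀ z ∈ ball (0 : VecField (F.P Kt) k (EuclideanSpace ℂ (Fin 3)) × VecField (F.P Kt) k (EuclideanSpace ℂ (Fin 3))) R, ∀ b i j, ‖Ũ z b i j‖ ≤ 𝓐) ∧
        ∀ p B' : VecField (F.P Kt) k E3, ‖p‖ < R → ‖B'‖ < R → ∃ U' : GaugeField (F.P Kt) 0 SU2,
          (∀ b, Ũ (cplxVec p, cplxVec B') b = ((U' b : SU2) : Matrix (Fin 2) (Fin 2) ℂ)) ∧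
            IsMinimizerB (Node00.avOfRecord F 2 Kt) (Node00.regMSCoPOfRecord F 2 ν Kt k (maxDomT ν.M₁ Z)) (bd k (maxDomT ν.M₁ Z))
              (avgFamily (Node00.avOfRecord F 2 Kt) (qsstarGIter0 k (expMul su2Chart B' (ext (expMul su2Chart p W))))) U') :
    ∀ V : GaugeField (F.P Kt) k SU2, PlaqSmallOn (plaqsInside (pts k (Z ∩ Λᶜ))) eR V →
      ∃ Ũ : VecField (F.P Kt) k (EuclideanSpace ℂ (Fin 3)) × VecField (F.P Kt) k (EuclideanSpace ℂ (Fin 3)) → PBond (F.P Kt) 0 → Matrix (Fin 2) (Fin 2) ℂ,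
        (∀ b i j, DifferentiableOn ℂ (fun z => Ũ z b i j) (ball 0 (R / 3))) ∧
        (∀ z ∈ ball (0 : VecField (F.P Kt) k (EuclideanSpace ℂ (Fin 3)) × VecField (F.P Kt) k (EuclideanSpace ℂ (Fin 3))) (R / 3), ∀ b i j, ‖Ũ z b i j‖ ≤ 4 * 𝓐) ∧
        ∀ p B' : VecField (F.P Kt) k E3, ‖p‖ < R / 3 → ‖B'‖ < R / 3 → ∃ U' : GaugeField (F.P Kt) 0 SU2,
          (∀ b, Ũ (cplxVec p, cplxVec B') b = ((U' b : SU2) : Matrix (Fin 2) (Fin 2) ℂ)) ∧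
            IsMinimizerB (Node00.avOfRecord F 2 Kt) (Node00.regMSCoPOfRecord F 2 ν Kt k (maxDomT ν.M₁ Z)) (bd k (maxDomT ν.M₁ Z))
              (avgFamily (Node00.avOfRecord F 2 Kt) (qsstarGIter0 k (expMul su2Chart B' (ext (expMul su2Chart p V))))) U' := by
  intro V hreg
  -- w6's normalising gauge: `1` on `Λ^{(k)}` and at the corner, commuting with the extension, flattening `Ṽ_k` on the region box
  obtain ⟨u', ũ, -, -, hũΛ, hũ₀, hcomm, hflat⟩ :=
    exists_gauge_normalising_extend_shellGauged (G := SU2) hd3 hlohi hn hN hbox hZ hLO hHI hn' hn'N hR heR hreg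
  -- the normalised representative lies in the strict guard
  have hregW : PlaqSmallOn (plaqsInside (pts k (Z ∩ Λᶜ))) eR (gaugeAct ũ V) := fun p hp => by
    rw [dist1_plaqHol_gaugeAct]
    exact hreg p hp
  -- and satisfies the datum letter on `𝒞 ⊆ boxBonds LO HI`
  have hDW : ∀ c ∈ 𝒞, dist1 ((ext (gaugeAct ũ V)) c) ≤ ρn := fun c hc => by
    rw [hext, hcomm]
    exact (hflat c (h𝒞 hc)).trans hρn
  -- the slice letter at the representative, returned along the orbit
  exact hMinBody_of_gaugeAct_normalised ν Kt hk bd Z hbd hN ext (fun W => by rw [hext, hbox]) ũ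
    (fun s hs => hũΛ s (by rw [hbox]; exact hs)) hũ₀ V (hslice (gaugeAct ũ V) hregW hDW)

end

end Literature.MathematicalPhysics.QuantumFieldTheory.Balaban1983to89.B15Prop1MinimiserFamilyOfNormalisedSliceB

end
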